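import Summits.HodgeConjecture.HodgeConjecture.Theorems.FermatSurfaceSeparationSigma

/-!
# Exotic Hodge pairs on Fermat squares, III — KERNEL closures: EXO-2′ holds, `AokiThmASix` is a theorem, `FermatSepCriterion m → FermatSep m`

Part 3 of 4 (Sketch §2 `section Closures`, ll. 564–684). Inputs, all LANDED sorry-free tree theorems: the line `cancel-by-any-claim-lattice`
of crux `HodgeFermatVarieties` (route `PadicSemiregularLift`, stmt-HodgeConjecture-1334) — `PairedNull.stub_exists_fibre_of_not_paired_pow`,
`CoprimeSix.stub_sigmaStd_of_fibre`, `CoprimeSix.exists_pairs_of_count_symm` — and cell pub-hfermat's `FermatCycles.AokiTheoremA.theoremA`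
(Aoki 1983 Thm A, kernel). Output: `exoTwoPrimeConjecture_holds` (conjecture EXO-2′ of memo ROUTE-P1AE §B3 is a THEOREM), `aokiThmASix_holds`,
`fermatSep_of_largePrimes` (all prime factors `≥ 11`), **`fermatSep_of_fermatSepCriterion : 1 < m → FermatSepCriterion m → FermatSep m`**
(the «⟸» half of the separation law, every `m`), `fermatSep_seven_mul_prime'`.

PROVENANCE. Cell hodge-nonav (HUMAN RULING D-0038), planner seat p1: chapters ROUTE-P1AE §B (g32) and ROUTE-P1AF + ADD (g33),
frozen Sketch `HOME/p1/route/Sketch_P1AF_ADD_SEPLAW_g33.lean` (sha16 9c70bd8d356ffb70, 1004 lines, namespace `HodgeNonAV.P1AF`,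
farm rc 0 / 0 sorries / axioms {propext, Classical.choice, Quot.sound}; referee PASS: REF-P1AF b32cd9c28a7cc495), split into
four tree modules `FermatSurfaceSeparationCriterion` → `…Sigma` → `…Closures` → `FermatSurfaceSeparationLaw` by planner p1 g34
(landing kit HOME/p1/landing/, 2026-08-28); bodies verbatim, namespace moved to that of `Theorems/FermatSurfaceExoticPairsDefs`.
Land with `--supports stmt-HodgeConjecture-19652 --as helper` (K6 ∕ evidence carrier of the non-AV index) or `--supports
stmt-HodgeConjecture-1334` (the Fermat line whose engines §2 consumes). No instance, no notation, no sorry, no new axiom.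
HONEST SCOPE: combinatorics of Shioda's Hodge-character semigroup of Fermat surfaces and sixfolds; NOTHING here proves the
Hodge conjecture or HC for any new variety — `FermatSep m` is the INPUT half of `HC⁴(X²ₘ × X²ₘ)` via the landed SQ-AUT theorem
`PgOneCyclotomicSquares.hodgeConjectureFor_square_of_endomorphisms`, and those squares are dominated by Fermat/abelian motives anyway.
References: N. Aoki, Math. Ann. 266 (1983) Thm A, §1 (𝔇ⁿₘ), §5 Thm D, Prop. 6.4/6.6, Lemma 7.3 [cite: Aoki1983, Thm. A];
N. Aoki, J. Math. Soc. Japan 39 (1987) Thm 2-1 [cite: Aoki1987, Thm. 2-1]; N. Aoki, Comment. Math. Univ. St. Pauli 49 (2000) Lemma 4.1;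
T. Shioda, Math. Ann. 245 (1979) Thm I–IV [cite: Shioda1979PJA, Thm. I]; Z. Ran, Compositio Math. 42 (1980) Prop. 1.8 [cite: Ran1980, Prop. 1.8];
G. da Silva Jr., arXiv:2101.04739 (2021) Thm 2.1–2.2, Prop. 3.1 [cite: daSilva2021HodgeFermat, Thm. 2.1].
-/

set_option linter.dupNamespace false

noncomputable section

namespace Summit.HodgeConjecture.HodgeConjecture.Theorems.FermatSurfaceExoticPairs

open Multiset Literature.AlgebraicGeometry.HodgeTheory.FermatCharacter

variable {m : ℕ}

/-! ## §2  KERNEL CLOSURES from the tree: conjecture EXO-2′ holds; `AokiThmASix` is a theorem; the «⟸» half of the separation law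

Inputs (all LANDED, sorry-free tree theorems): the line `cancel-by-any-claim-lattice` of crux `HodgeFermatVarieties`
(route `PadicSemiregularLift`, stmt-HodgeConjecture-1334) — `PairedNull.stub_exists_fibre_of_not_paired_pow` (GS²-L2: at a
level prime to `6` whose prime factors `≠ p₁` are `≥ #s + 3`, a non-symmetric Hodge multiset contains `p₁ − 1` points of a
progression `{A + j(m/p₁)}` with `p₁A ≠ 0`), `CoprimeSix.stub_sigmaStd_of_fibre` (GP-L3: for `#s = p₁ + 1` those points force
pairs or `σ_{p₁,A}`), `CoprimeSix.exists_pairs_of_count_symm` (symmetric ⇒ pairs); and `FermatCycles.AokiTheoremA.theoremA`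
(cell pub-hfermat: Aoki 1983 Thm A, kernel). -/

section Closures

open Summit.HodgeConjecture.HodgeConjecture.Theorems.CancelByAnyClaimLattice
open Summit.HodgeConjecture.FermatCycles.AokiTheoremA

/-- `Q + (−Q)` is pair-symmetric. [cite: Aoki1983, §1 (𝔇ⁿₘ)] -/
theorem isPairSymmetric_of_eq_pairs {s Q : Multiset (ZMod m)} (h : s = Q + Q.map (fun a ↦ -a)) :
    IsPairSymmetric s := by
  subst h
  have hc : ∀ x : ZMod m, count x (Q.map fun a ↦ -a) = count (-x) Q := fun x ↦ by
    have h' := count_map_eq_count' (fun a : ZMod m ↦ -a) Q neg_injective (-x)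
    simpa using h'
  refine ⟨fun x ↦ ?_, fun a _ ha ↦ ?_⟩
  · rw [Multiset.count_add, Multiset.count_add, hc, hc, neg_neg, add_comm]
  · rw [Multiset.count_add, hc, ← ha]
    exact ⟨count a Q, rfl⟩

/-- **Hodge OCTUPLES at an EXO-2′ degree are pairs or `σ₇`-sets** (`m` odd, `7 ∣ m`, every prime factor `≥ 7`; any power of
`7` allowed): assembled from the tree's GS²-L2 (the other prime factors are `≥ 11 = 8 + 3`), GP-L3 and the symmetric split.
[cite: Aoki1983, Thm. A′ (§7)] [cite: Aoki1987, §1 p. 387] -/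
theorem octuple_pairs_or_sigma_of_exoTwoPrimeDegree [NeZero m] (hm : ExoTwoPrimeDegree m)
    {s : Multiset (ZMod m)} (hs : IsHodgeMultiset s) (h8 : card s = 8) :
    (∃ Q : Multiset (ZMod m), (∀ a ∈ Q, a ≠ 0) ∧ s = Q + Q.map (fun a ↦ -a)) ∨ IsSigmaSet 7 s := by
  obtain ⟨-, h7, hge⟩ := hm
  have hm6 : m.Coprime 6 := by
    refine Nat.coprime_of_dvd fun q hq hqm hq6 ↦ ?_
    have h7q := hge q hq hqm
    have hq6' : q ≤ 6 := Nat.le_of_dvd (by norm_num) hq6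
    omega
  have hmin : ∀ q ∈ m.primeFactors, 7 ≤ q := fun q hq ↦
    hge q (Nat.mem_primeFactors.mp hq).1 (Nat.mem_primeFactors.mp hq).2.1
  have hbig : ∀ q ∈ m.primeFactors, q ≠ 7 → card s + 3 ≤ q := by
    intro q hq hq7
    have hqp : q.Prime := (Nat.mem_primeFactors.mp hq).1
    have h7q := hmin q hq
    rw [h8]
    by_contra hlt
    have hq10 : q ≤ 10 := by omega
    interval_cases q
    · exact hq7 rfl
    · exact absurd hqp (by decide)
    · exact absurd hqp (by decide)
    · exact absurd hqp (by decide)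
  by_cases hsym : ∀ x : ZMod m, count x s = count (-x) s
  · exact Or.inl (CoprimeSix.exists_pairs_of_count_symm hm6 _ s rfl hs hsym)
  · push Not at hsym
    obtain ⟨-, A, hA, hfib⟩ :=
      PairedNull.stub_exists_fibre_of_not_paired_pow 7 (by norm_num) (by norm_num) m hm6 s hs hbig hsym
    rcases CoprimeSix.stub_sigmaStd_of_fibre 7 (by norm_num) (by norm_num) m hmin h7 s hs h8 A hA hfib with h | h
    · exact Or.inl h
    · exact Or.inr ⟨A, hA, h⟩

/-- **KERNEL — CONJECTURE EXO-2′ HOLDS** (`ExoTwoPrimeConjecture` of ROUTE-P1AE §B3): `FermatSep m` — the Fermat surface `X²ₘ`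
has no exotic Hodge pairs — for every odd `m` with `7 ∣ m` and all prime factors `≥ 7` (`49, 77, 91, 119, 133, …, 343, …,
1001, …`). For a Hodge pair `(u, w)` the octuple `u ⊎ (−w)` is pairs (then `w = u`, P1AE kernel) or a `σ₇`-set (impossible:
`u` would be a zero-sum sub-quadruple, §1). [cell hodge-nonav memo ROUTE-P1AF §B] [cite: Aoki1983, Thm. A′ (§7)] -/
theorem exoTwoPrimeConjecture_holds : ExoTwoPrimeConjecture := by
  intro m hm
  haveI : NeZero m := ⟨by
    rintro rfl
    exact absurd hm.1 (by decide)⟩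
  rintro u w ⟨hu, hw, hs⟩
  have hcard : card (u + negM w) = 8 := by rw [Multiset.card_add, card_negM, hu.1, hw.1]
  rcases octuple_pairs_or_sigma_of_exoTwoPrimeDegree hm hs hcard with ⟨Q, -, hQ⟩ | ⟨A, hA, hσ⟩
  · have key := eq_negM_of_isPairSymmetric_add hu (isTransQuad_negM hw) (isPairSymmetric_of_eq_pairs hQ)
    have h' := congrArg negM key
    rw [negM_negM, negM_negM] at h'
    exact h'.symm
  · exact (false_of_subquad_sigmaSet_seven hm.1 hm.2.1 hA (by rw [← hσ]; exact Multiset.le_add_right u _)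
      hu.1 hu.2.2.1).elim

/-- **Aoki's Thm A (ii) at `n = 6` is a theorem of the tree** (cell pub-hfermat, `FermatCycles.AokiTheoremA.theoremA`): the P1AE
hypothesis shape `AokiThmASix m` HOLDS for every `m`. [cite: Aoki1983, Thm. A (ii)] -/
theorem aokiThmASix_holds (m : ℕ) : AokiThmASix m := by
  intro hbig s hs h8
  rcases Nat.eq_zero_or_pos m with rfl | hm0
  · exact absurd (hbig 2 Nat.prime_two (dvd_zero 2)) (by norm_num)
  haveI : NeZero m := ⟨by omega⟩
  rcases Nat.lt_or_ge m 2 with hlt | h2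
  · -- `m = 1`: `ℤ/1` is trivial, so a Hodge multiset (zero-free) is empty — not of cardinality `8`
    exfalso
    have hm1 : m = 1 := by omega
    subst hm1
    obtain ⟨a, ha⟩ := Multiset.card_pos_iff_exists_mem.1 (by rw [h8]; norm_num : 0 < card s)
    exact hs.1.1 a ha (Subsingleton.elim a 0)
  · have hall : ∀ p ∈ m.primeFactors, 6 + 2 < p := fun p hp ↦ by
      have h := hbig p (Nat.mem_primeFactors.mp hp).1 (Nat.mem_primeFactors.mp hp).2.1
      omega
    obtain ⟨Q, -, hQ⟩ := (theoremA (m := m) h2 (n := 6) (by decide) (by norm_num)).2 (Or.inr (Or.inr hall))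
      s hs (by rw [h8])
    exact isStandard_of_isPairSymmetric s hs (isPairSymmetric_of_eq_pairs hQ)

/-- **KERNEL — `FermatSep m` for every `m` all of whose prime factors are `≥ 11`**, now UNCONDITIONAL (P1AE's
`fermatSep_of_aokiThmASix` with its hypothesis discharged by the tree). [cite: Aoki1983, Thm. A (ii)] -/
theorem fermatSep_of_largePrimes [NeZero m] (hm : ∀ p : ℕ, p.Prime → p ∣ m → 8 < p) : FermatSep m :=
  fermatSep_of_aokiThmASix (aokiThmASix_holds m) hm

/-- **KERNEL — THE «⟸» HALF OF THE SEPARATION LAW (EXO-3 ∕ `FermatSepConjecture` of ROUTE-P1AD), UNCONDITIONALLY:**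
for `m ≥ 2`, `FermatSepCriterion m → FermatSep m` — i.e. the Fermat surface `X²ₘ` has NO exotic Hodge pairs whenever `m` is
prime, or `m = 4`, or `m` is odd with every prime factor `≥ 7`. (The «⟹» half — exotic pairs exist at every other `m` — is
witnessed in kernel at `m = 6, 8, 9, 15, 21` only, ROUTE-P1AD; it stays a conjecture for general `m`.)
[cell hodge-nonav memo ROUTE-P1AF §B] [cite: Aoki1983, Thm. A, Thm. A′] -/
theorem fermatSep_of_fermatSepCriterion (hm : 1 < m) (h : FermatSepCriterion m) : FermatSep m :=
  fermatSep_of_criterion aokiThmASix_holds exoTwoPrimeConjecture_holds hm h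

/-- **COROLLARY — `FermatSep (7·q)` for every prime `q ≥ 11`, unconditionally** (supersedes `fermatSep_seven_mul_prime`'s
hypothesis `TwoPrimeFirstExoticLength`; equivalently: the tree's `PQ.stub_pqClassification` at `p = 7`). [cite: Aoki1983, Thm. A′ (§7)] -/
theorem fermatSep_seven_mul_prime' {q : ℕ} (hq : q.Prime) (h11 : 11 ≤ q) : FermatSep (7 * q) :=
  exoTwoPrimeConjecture_holds (7 * q) (exoTwoPrimeDegree_seven_mul hq h11)

end Closures

end Summit.HodgeConjecture.HodgeConjecture.Theorems.FermatSurfaceExoticPairs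

end
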